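import Literature.Barriers.MatrixMultiplication.NilpotentGroupBarrierPSeries
import HarnessLib

/-!
# A `p`-central generating system with FULLY INVARIANT levels

Solo-informed seat (MatrixMultiplication), gen 102; sharpest-statement §2y(8), towards Theorem B″ for
NON-ABELIAN hosts (Cohn–Umans 2013 §6.3: group association schemes `𝒮(G, Inn G)` and their fusions
by automorphisms). The tree's `exists_pcgs` (BCCGU 2017 Def. 3.5 / Prop. 3.10) builds a `p`-central
generating system of a finite `p`-group of class `≤ c` and exponent dividing `p^e` from the refined
lower central series `H_s = P_{s/e, s%e}` (`levelH`), but forgets the relation between the generators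
and the `H_s`. Here we re-run the construction keeping it:

* `map_lcs_le`, `map_refLCS_le`, `map_levelH_le` — the refined lower central series is FULLY
  INVARIANT: `φ(H_s) ≤ H_s` for every endomorphism `φ` (verbal subgroups).
* `exists_pcgs_levels` — `exists_pcgs` with two extra conclusions: `gen a ∈ H_{lvl a}`, and
  `H_s ≤ ⟨gen b : lvl b ≥ s⟩`.
* `exists_levelPCGS_of_pGroup` — hence EVERY endomorphism maps each generator into the subgroup
  generated by the generators of at least its level: the hypothesis of the twisted codimension bound
  `card_le_of_levelTwistedMatching` holds for every finite `p`-group of bounded class and exponent.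

References: BlasiakChurchCohnGrochowUmans2017 (arXiv:1712.02302) Def. 3.5, Prop. 3.10, Cor. 3.20;
CohnUmans2013 (arXiv:1207.6528) §6.3; S. A. Jennings, Trans. AMS 50 (1941).
-/

noncomputable section

open scoped BigOperators commutatorElement Pointwise
open Finset Literature.Barriers.MatrixMultiplication

namespace Summit.MatrixMultiplication.MatrixMultiplication.Theorems.TwistedSliceRank

section Invariance

variable {p : ℕ} {S : Type*} [Group S]

/-- The lower central series is fully invariant. [folklore] -/
theorem map_lcs_le (φ : S →* S) (k : ℕ) : (lcs S k).map φ ≤ lcs S k := by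
  show ((⊤ : Subgroup S).lowerCentralSeries k).map φ ≤ (⊤ : Subgroup S).lowerCentralSeries k
  rw [Subgroup.map_lowerCentralSeries]
  induction k with
  | zero => exact le_top
  | succ n ih =>
    rw [Subgroup.lowerCentralSeries_succ, Subgroup.lowerCentralSeries_succ]
    exact Subgroup.commutator_mono ih le_top

/-- The refined lower central series `P_{k,i}` is fully invariant. [folklore] -/
theorem map_refLCS_le (φ : S →* S) (k i : ℕ) : (refLCS p S k i).map φ ≤ refLCS p S k i := by
  unfold refLCS
  rw [Subgroup.map_sup]
  refine sup_le_sup ?_ (map_lcs_le φ (k + 1))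
  refine (Subgroup.map_normalClosure_le _ _).trans (Subgroup.normalClosure_mono ?_)
  rintro _ ⟨_, ⟨x, hx, rfl⟩, rfl⟩
  exact ⟨φ x, map_lcs_le φ k ⟨x, hx, rfl⟩, by simp only [map_pow]⟩

/-- The levels `H_s` are fully invariant: `φ(H_s) ≤ H_s` for every endomorphism. [folklore] -/
theorem map_levelH_le {e : ℕ} (φ : S →* S) (s : ℕ) :
    (levelH p S e s).map φ ≤ levelH p S e s :=
  map_refLCS_le φ _ _

end Invariance

section Levels

variable {p : ℕ} [hp : Fact p.Prime] {S : Type*} [Group S] [Finite S]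

/-- **`p`-central generating system with remembered levels** (clone of the tree's `exists_pcgs`,
BCCGU 2017 Def. 3.5 / Prop. 3.10): generators `gen a ∈ H_{lvl a}` and `H_s ≤ ⟨gen b : lvl b ≥ s⟩`.
[cite: BlasiakChurchCohnGrochowUmans2017, Def. 3.5 and Prop. 3.10] -/
theorem exists_pcgs_levels [Group.IsNilpotent S] {c e : ℕ} (he : 0 < e)
    (hc : Group.nilpotencyClass S ≤ c) (hexp : Monoid.exponent S ∣ p ^ e) :
    ∃ (ι : Type) (_ : LinearOrder ι) (_ : Fintype ι) (C : PCGS p S ι), C.L = c * e ∧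
      (∀ a, C.gen a ∈ levelH p S e (C.lvl a)) ∧
      (∀ (s : ℕ) (x : S), x ∈ levelH p S e s →
        x ∈ Subgroup.closure (C.gen '' {b | s ≤ C.lvl b})) := by
  classical
  set L := c * e with hL
  set H : ℕ → Subgroup S := levelH p S e with hH
  have Hanti : Antitone H := levelH_antitone he
  have HL : H L = ⊥ := levelH_eq_bot he hc
  have H0 : H 0 = ⊤ := levelH_zero
  have Hcomm : ∀ s, ⁅H s, (⊤ : Subgroup S)⁆ ≤ H (s + 1) := commutator_levelH_le he
  have Hpow : ∀ s, ∀ y ∈ H s, y ^ p ∈ H (s + 1) := fun s y hy => pow_p_mem_levelH_succ he hexp hy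
  -- per-level generators
  have hlev : ∀ s : Fin L, ∃ (r : ℕ) (g : ℕ → S), (∀ j, g j ∈ H s) ∧
      Nat.card (H s) = p ^ r * Nat.card (H (s + 1)) ∧
      ∀ x ∈ H s, ∃ m : ℕ → ℕ, (∀ j, m j < p) ∧ ∀ l : List ℕ, l.Nodup → (∀ j, j ∈ l ↔ j < r) →
        ∃ z ∈ H (s + 1), x = (l.map fun j => g j ^ m j).prod * z := by
    intro s
    haveI : (H (s + 1)).Normal := by rw [hH]; infer_instance
    exact exists_level_gens (H s) (H (s + 1)) (Hanti (Nat.le_succ _))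
      ((Subgroup.commutator_mono le_rfl le_top).trans (Hcomm s)) (Hpow s)
  choose r g hgH hcard hrepr using hlev
  -- the alphabet
  let ι := Lex (Σ s : Fin L, Fin (r s))
  let lvl : ι → ℕ := fun a => ((ofLex a).1 : ℕ)
  let gen : ι → S := fun a => g (ofLex a).1 (ofLex a).2
  have lvl_mono : Monotone lvl := by
    intro a b hab
    rcases (Sigma.Lex.le_def.1 hab) with h | ⟨h, -⟩
    · exact (Fin.lt_def.1 h).le
    · exact (Fin.ext_iff.1 h).le
  have lvl_lt : ∀ a, lvl a < L := fun a => (ofLex a).1.2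
  have gen_mem : ∀ a, gen a ∈ H (lvl a) := fun a => hgH _ _
  -- normal forms, by descending induction on the level
  have hrep : ∀ d s, s + d = L → ∀ x ∈ H s, ∃ ex : ι → ℕ, (∀ a, ex a < p) ∧
      (∀ a, lvl a < s → ex a = 0) ∧ x = orderedProd gen ex := by
    intro d
    induction d with
    | zero =>
      intro s hs x hx
      rw [Nat.add_zero] at hs
      subst hs
      rw [HL, Subgroup.mem_bot] at hx
      subst hx
      refine ⟨fun _ => 0, fun _ => hp.out.pos, fun _ _ => rfl, ?_⟩
      rw [orderedProd, prod_map_pow_eq_one _ _ _ (fun _ _ => rfl)]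
    | succ d ih =>
      intro s hs x hx
      have hsL : s < L := by omega
      set s' : Fin L := ⟨s, hsL⟩ with hs'
      obtain ⟨m, hm, hml⟩ := hrepr s' x hx
      -- the level-`s` letters, in alphabet order
      set F := (Finset.univ : Finset ι).sort (· ≤ ·) with hF
      set l : List ℕ := (F.filter fun a => lvl a = s).map fun a => ((ofLex a).2 : ℕ) with hl
      have hlnodup : l.Nodup := by
        refine List.Nodup.map_on ?_ ((Finset.sort_nodup _ _).filter _)
        intro a ha b hb hab
        simp only [List.mem_filter, decide_eq_true_eq] at ha hb
        -- same level and same index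
        apply ofLex.injective
        have h1 : (ofLex a).1 = (ofLex b).1 := Fin.ext (ha.2.trans hb.2.symm)
        exact Sigma.ext h1 ((Fin.heq_ext_iff (by rw [h1])).2 hab)
      have hlmem : ∀ j, j ∈ l ↔ j < r s' := by
        intro j
        simp only [hl, List.mem_map, List.mem_filter, hF, Finset.mem_sort, Finset.mem_univ,
          true_and, decide_eq_true_eq]
        constructor
        · rintro ⟨a, ha, rfl⟩
          have h1 : (ofLex a).1 = s' := Fin.ext ha
          have key : ∀ (q : Σ s : Fin L, Fin (r s)), q.1 = s' → ((q.2 : ℕ)) < r s' := by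
            rintro ⟨q1, q2⟩ hq
            simp only at hq
            subst hq
            exact q2.2
          exact key (ofLex a) h1
        · intro hj
          refine ⟨toLex ⟨s', ⟨j, hj⟩⟩, ?_, ?_⟩
          · simp [lvl, hs']
          · simp
      obtain ⟨z, hz, hxz⟩ := hml l hlnodup hlmem
      obtain ⟨ez, hez, hez0, hzeq⟩ := ih (s + 1) (by omega) z hz
      -- the exponent vector
      let ex : ι → ℕ := fun a => ez a + if lvl a = s then m ((ofLex a).2 : ℕ) else 0
      have hexs : ∀ a, lvl a = s → ex a = m ((ofLex a).2 : ℕ) := by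
        intro a ha
        simp only [ex, if_pos ha, hez0 a (by omega), zero_add]
      have hexo : ∀ a, lvl a ≠ s → ex a = ez a := by
        intro a ha
        simp only [ex, if_neg ha, add_zero]
      refine ⟨ex, fun a => ?_, fun a ha => ?_, ?_⟩
      · by_cases h : lvl a = s
        · rw [hexs a h]; exact hm _
        · rw [hexo a h]; exact hez a
      · rw [hexo a (by omega)]; exact hez0 a (by omega)
      -- the product
      have hsplit := fun (e' : ι → ℕ) => prod_map_split lvl lvl_mono (fun a => gen a ^ e' a) s F
        (Finset.pairwise_sort _ _)
      have hPex : orderedProd gen ex = ((F.filter fun a => lvl a = s).map fun a => gen a ^ ex a).prod *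
          ((F.filter fun a => s < lvl a).map fun a => gen a ^ ez a).prod := by
        rw [orderedProd, ← hF, hsplit ex, prod_map_pow_eq_one, one_mul]
        · congr 1
          refine congrArg _ (List.map_congr_left fun a ha => ?_)
          simp only [List.mem_filter, decide_eq_true_eq] at ha
          rw [hexo a (by omega)]
        · intro a ha
          simp only [List.mem_filter, decide_eq_true_eq] at ha
          rw [hexo a (by omega)]
          exact hez0 a (by omega)
      have hPez : orderedProd gen ez = ((F.filter fun a => s < lvl a).map fun a => gen a ^ ez a).prod := by
        rw [orderedProd, ← hF, hsplit ez, prod_map_pow_eq_one, one_mul, prod_map_pow_eq_one, one_mul]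
        · intro a ha
          simp only [List.mem_filter, decide_eq_true_eq] at ha
          exact hez0 a (by omega)
        · intro a ha
          simp only [List.mem_filter, decide_eq_true_eq] at ha
          exact hez0 a (by omega)
      have hmid : ((F.filter fun a => lvl a = s).map fun a => gen a ^ ex a).prod =
          (l.map fun j => g s' j ^ m j).prod := by
        rw [hl, List.map_map]
        refine congrArg _ (List.map_congr_left fun a ha => ?_)
        simp only [List.mem_filter, decide_eq_true_eq] at ha
        have h1 : (ofLex a).1 = s' := Fin.ext ha.2
        simp only [Function.comp_apply, gen, hexs a ha.2, h1]
      rw [hPex, hmid, ← hPez, ← hzeq]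
      exact hxz
  -- packaging
  have hrep' : ∀ s ≤ L, ∀ x ∈ H s, ∃ ex : ι → ℕ, (∀ a, ex a < p) ∧
      (∀ a, lvl a < s → ex a = 0) ∧ x = orderedProd gen ex :=
    fun s hs x hx => hrep (L - s) s (by omega) x hx
  -- commutators and powers of generators
  have hcommH : ∀ a b : ι, ⁅gen a, gen b⁆ ∈ H (max (lvl a) (lvl b) + 1) := by
    intro a b
    have ha : ⁅gen a, gen b⁆ ∈ H (lvl a + 1) :=
      Hcomm _ (Subgroup.commutator_mem_commutator (gen_mem a) (Subgroup.mem_top _))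
    have hb : ⁅gen a, gen b⁆ ∈ H (lvl b + 1) := by
      rw [← commutatorElement_inv]
      exact inv_mem (Hcomm _ (Subgroup.commutator_mem_commutator (gen_mem b) (Subgroup.mem_top _)))
    rcases le_total (lvl a) (lvl b) with h | h
    · rw [max_eq_right h]; exact hb
    · rw [max_eq_left h]; exact ha
  have hmaxL : ∀ a b : ι, max (lvl a) (lvl b) + 1 ≤ L := fun a b =>
    Nat.succ_le_of_lt (max_lt (lvl_lt a) (lvl_lt b))
  choose commExp hcommExp_lt hcommExp_lvl hcommExp_prod using
    fun a b : ι => hrep' _ (hmaxL a b) _ (hcommH a b)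
  choose powExp hpowExp_lt hpowExp_lvl hpowExp_prod using
    fun a : ι => hrep' _ (Nat.succ_le_of_lt (lvl_lt a)) _ (Hpow _ _ (gen_mem a))
  -- cardinality
  have hcardH : ∀ d s, s + d = L →
      Nat.card (H s) = p ^ (∑ t ∈ Finset.univ.filter (fun t : Fin L => s ≤ (t : ℕ)), r t) := by
    intro d
    induction d with
    | zero =>
      intro s hs
      rw [Nat.add_zero] at hs
      subst hs
      rw [HL, Subgroup.card_bot]
      have : (Finset.univ.filter fun t : Fin L => L ≤ (t : ℕ)) = ∅ := by
        ext t; simp [Nat.not_le.2 t.2]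
      rw [this, Finset.sum_empty, pow_zero]
    | succ d ih =>
      intro s hs
      have hsL : s < L := by omega
      rw [hcard ⟨s, hsL⟩, ih (s + 1) (by omega), ← pow_add]
      congr 1
      have : (Finset.univ.filter fun t : Fin L => s ≤ (t : ℕ)) =
          insert ⟨s, hsL⟩ (Finset.univ.filter fun t : Fin L => s + 1 ≤ (t : ℕ)) := by
        ext t
        simp only [Finset.mem_filter, Finset.mem_univ, true_and, Finset.mem_insert, Fin.ext_iff]
        omega
      rw [this, Finset.sum_insert]
      simp
  have hcardS : Nat.card S = p ^ Fintype.card ι := by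
    rw [← Subgroup.card_top (G := S), ← H0, hcardH L 0 (by omega)]
    congr 1
    rw [Fintype.card_lex, Fintype.card_sigma]
    simp only [Fintype.card_fin]
    refine Finset.sum_congr ?_ fun _ _ => rfl
    ext t; simp
  refine ⟨ι, inferInstance, inferInstance,
    { L := L
      lvl := lvl
      gen := gen
      commExp := commExp
      powExp := powExp
      lvl_lt := lvl_lt
      lvl_mono := lvl_mono
      commExp_lt := fun a b c => hcommExp_lt a b c
      commExp_lvl := fun a b c hc => by
        by_contra hcon
        exact hc (hcommExp_lvl a b c (by omega))
      commExp_prod := fun a b => hcommExp_prod a b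
      powExp_lt := fun a c => hpowExp_lt a c
      powExp_lvl := fun a c hc => by
        by_contra hcon
        exact hc (hpowExp_lvl a c (by omega))
      powExp_prod := fun a => hpowExp_prod a
      exists_exp := fun x => by
        obtain ⟨ex, h1, -, h2⟩ := hrep' 0 (Nat.zero_le _) x (by rw [H0]; exact Subgroup.mem_top x)
        exact ⟨ex, h1, h2⟩
      card_eq := hcardS }, rfl, fun a => gen_mem a, ?_⟩
  intro s x hx
  show x ∈ Subgroup.closure (gen '' {b | s ≤ lvl b})
  rcases le_or_gt s L with hsL | hsL
  · obtain ⟨ex, -, hex0, rfl⟩ := hrep' s hsL x hx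
    unfold orderedProd
    refine Subgroup.list_prod_mem _ (fun y hy => ?_)
    obtain ⟨a, -, rfl⟩ := List.mem_map.1 hy
    by_cases ha : lvl a < s
    · rw [hex0 a ha, pow_zero]
      exact Subgroup.one_mem _
    · have ha' : gen a ∈ gen '' {b | s ≤ lvl b} :=
        ⟨a, by simp only [Set.mem_setOf_eq]; omega, rfl⟩
      exact Subgroup.pow_mem _ (Subgroup.subset_closure ha') _
  · have h1 : x ∈ H L := Hanti hsL.le hx
    rw [HL, Subgroup.mem_bot] at h1
    subst h1
    exact Subgroup.one_mem _

/-- **Every endomorphism of a finite `p`-group of bounded class and exponent respects the levels**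
of the `p`-central generating system of `exists_pcgs_levels`. [this work] -/
theorem exists_levelPCGS_of_pGroup [Group.IsNilpotent S] {c e : ℕ} (he : 0 < e)
    (hc : Group.nilpotencyClass S ≤ c) (hexp : Monoid.exponent S ∣ p ^ e) :
    ∃ (ι : Type) (_ : LinearOrder ι) (_ : Fintype ι) (C : PCGS p S ι), C.L = c * e ∧
      ∀ (φ : S →* S) (a : ι),
        φ (C.gen a) ∈ Subgroup.closure (C.gen '' {b | C.lvl a ≤ C.lvl b}) := by
  obtain ⟨ι, _, _, C, hL, hgen, hclos⟩ := exists_pcgs_levels (p := p) (S := S) he hc hexp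
  exact ⟨ι, _, _, C, hL, fun φ a => hclos _ _ (map_levelH_le φ _ ⟨C.gen a, hgen a, rfl⟩)⟩

end Levels

end Summit.MatrixMultiplication.MatrixMultiplication.Theorems.TwistedSliceRank
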